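import Summits.QuantumAdvantage.QuantumAdvantage.Theorems.LinnikCubicClassGroupsDegreeOnePrimesEscapeLeastPrimeIdeal
import Literature.NumberTheory.LFunctions.DegreeOnePrimesPNT
import Mathlib.NumberTheory.Chebyshev
import Literature.NumberTheory.LFunctions.UniformClassGroupPNTChebyshev
import Mathlib.RingTheory.IntegralDomain
import HarnessLib

/-!
# Analytic inputs for the cubic Chebotarev–Linnik theorems

Topic `Summits/QuantumAdvantage/QuantumAdvantage/Theorems`, cell B2b-1 (linnik-cubic), PART A (gen 7);
helper toward the crux `DegreeOnePrimesEscape` (stmt-QuantumAdvantage-11543) of route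
`LinnikCubicClassGroups`.  HONEST FRAMING: the value of this file is a THEOREM — NOT summit progress.

* `chebyshevThetaIdeal_le_uniform` — **an upper bound of prime-number-theorem strength, uniform over
  all number fields of a fixed degree, in the Linnik range**: for `n > 1`, `η > 0` there is
  `a = a(n, η)` with `θ_K(x) ≤ (1 + η) x` for every number field `K` of degree `n` and every
  `x ≥ Q^{a}` (`Q = |d_K| nⁿ`).  It is read off the unconditional class prime number theorem with
  relative error (`thetaClass_relative`, Deuring–Heilbronn): in the exceptional case the main terms
  `x − χ₁(C) x^{β₁}/β₁` summed over the classes give `x − 𝟙[χ₁ = 1] x^{β₁}/β₁ ≤ x`.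
* `degreeOneTheta_eventually` — for a FIXED number field `E`, `(1 − η) x ≤ θ¹_E(x) ≤ (1 + η) x` for
  `x ≥ x₀(E, η)` (Landau's prime ideal theorem, `abs_degreeOneTheta_sub_self_le`);
  `chebyshevTheta_eventually_ge` — the case `E = ℚ`: `θ(x) ≥ (1 − η) x`.
-/

noncomputable section

open scoped NumberField nonZeroDivisors
open Finset Real Ideal NumberField
open Literature.NumberTheory.NumberFields Literature.NumberTheory.LFunctions
  Literature.NumberTheory.LFunctions.NumberField

namespace Summit.QuantumAdvantage.QuantumAdvantage.Theorems.DegreeOnePrimesEscape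

/-! ### The uniform upper bound `θ_K(x) ≤ (1 + η) x` in the Linnik range -/

/-- Orthogonality in the form needed: `Σ_C Re χ(C) ≥ 0` for a class group character (`= h_K` if
`χ = 1`, `= 0` otherwise). -/
theorem sum_re_classGroupChar_nonneg (K : Type*) [Field K] [NumberField K]
    (χ : ClassGroup (𝓞 K) →* ℂˣ) : 0 ≤ ∑ C : ClassGroup (𝓞 K), ((χ C : ℂ)).re := by
  classical
  by_cases hχ : χ = 1
  · subst hχ
    simp
  · have hψ : (Units.coeHom ℂ).comp χ ≠ 1 := by
      intro heq
      apply hχ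
      ext C
      have := DFunLike.congr_fun heq C
      simpa using this
    have h0 := sum_hom_units_eq_zero ((Units.coeHom ℂ).comp χ) hψ
    rw [← Complex.re_sum]
    have : ∑ C : ClassGroup (𝓞 K), (χ C : ℂ) =
        ∑ C : ClassGroup (𝓞 K), ((Units.coeHom ℂ).comp χ) C :=
      Finset.sum_congr rfl fun C _ => rfl
    rw [this, h0, Complex.zero_re]

/-- **`θ_K(x) ≤ (1 + η) x` uniformly over the number fields of degree `n`, for `x ≥ Q^{a(n, η)}`**
(from the class prime number theorem with relative error, `thetaClass_relative`; unconditional).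
[cite: ThornerZaman2019, Theorem 1.4] -/
theorem chebyshevThetaIdeal_le_uniform (n : ℕ) (hn : 1 < n) {η : ℝ} (hη : 0 < η) :
    ∃ a : ℝ, 1 ≤ a ∧ ∀ (K : Type) [Field K] [NumberField K], Module.finrank ℚ K = n →
      ∀ x : ℝ, ThornerZaman.condQn K ^ a ≤ x → chebyshevThetaIdeal K x ≤ (1 + η) * x := by
  classical
  obtain ⟨a₂, c, ha₂, hc, hcn, hrel⟩ := thetaClass_relative n hn hη
  refine ⟨a₂, ha₂, fun K _ _ hKn x hx => ?_⟩
  have hK : 1 < Module.finrank ℚ K := by rw [hKn]; exact hn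
  have hQ12 : (12 : ℝ) ≤ ThornerZaman.condQn K := ThornerZaman.twelve_le_condQn (K := K) hK
  have hx1 : 1 ≤ x := by
    have : (1 : ℝ) ≤ ThornerZaman.condQn K ^ a₂ := Real.one_le_rpow (by linarith) (by linarith)
    linarith
  have hx0 : 0 ≤ x := by linarith
  set h : ℝ := (NumberField.classNumber K : ℝ) with hh
  have hh1 : 1 ≤ h := by rw [hh]; exact_mod_cast one_le_classNumber (K := K)
  have hh0 : 0 < h := by linarith
  have hcard : (Fintype.card (ClassGroup (𝓞 K)) : ℝ) = h := by
    rw [hh, show NumberField.classNumber K = Fintype.card (ClassGroup (𝓞 K)) from rfl]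
  rw [← sum_chebyshevThetaIdealClass K x]
  rcases hrel K hKn with h1 | ⟨χ₁, β₁, -, hβlo, -, -, h2⟩
  · have hC : ∀ C : ClassGroup (𝓞 K), chebyshevThetaIdealClass K C x ≤ (1 + η) * x / h := by
      intro C
      have := abs_le.mp (h1 x hx C)
      have e : (1 + η) * x / h = x / h + η * x / h := by ring
      rw [e]; linarith [this.2]
    calc ∑ C, chebyshevThetaIdealClass K C x ≤ ∑ _C : ClassGroup (𝓞 K), (1 + η) * x / h :=
          Finset.sum_le_sum fun C _ => hC C
      _ = (1 + η) * x := by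
          rw [Finset.sum_const, Finset.card_univ, nsmul_eq_mul, hcard]
          field_simp
  · -- the exceptional case: `Σ_C M_C = h x − (Σ_C Re χ₁(C)) x^{β₁}/β₁ ≤ h x`
    have hlog4 : 1 < Real.log 4 := by
      rw [show (4 : ℝ) = 2 ^ 2 by norm_num, Real.log_pow]
      have := Real.log_two_gt_d9
      push_cast; linarith
    have hlogd : 0 ≤ Real.log ((NumberField.discr K).natAbs : ℝ) := Real.log_natCast_nonneg _
    have hn2 : (2 : ℝ) ≤ n := by exact_mod_cast hn
    have hc1 : c < 1 := by
      have : 1 / (8 * ((n : ℝ) ^ 2 + 1)) < 1 := by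
        rw [div_lt_one (by positivity)]; nlinarith
      linarith
    have hβ0 : 0 < β₁ := by
      have : c / (Real.log ((NumberField.discr K).natAbs : ℝ) + Real.log 4) ≤ c / 1 :=
        div_le_div_of_nonneg_left hc.le one_pos (by linarith)
      rw [div_one] at this
      linarith
    set S : ℝ := ∑ C : ClassGroup (𝓞 K), ((χ₁ C : ℂ)).re with hS
    have hS0 : 0 ≤ S := sum_re_classGroupChar_nonneg K χ₁
    have hpow : 0 ≤ x ^ β₁ / β₁ := div_nonneg (Real.rpow_nonneg hx0 _) hβ0.le
    have hC : ∀ C : ClassGroup (𝓞 K), chebyshevThetaIdealClass K C x ≤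
        (1 + η) / h * (x - ((χ₁ C : ℂ)).re * (x ^ β₁ / β₁)) := by
      intro C
      obtain ⟨-, hθ⟩ := h2 x hx C
      have := (abs_le.mp hθ).2
      have e : (1 + η) / h * (x - ((χ₁ C : ℂ)).re * (x ^ β₁ / β₁)) =
          (x - ((χ₁ C : ℂ)).re * x ^ β₁ / β₁) / h +
            η * (x - ((χ₁ C : ℂ)).re * x ^ β₁ / β₁) / h := by
        field_simp
      rw [e]; linarith
    calc ∑ C, chebyshevThetaIdealClass K C x
        ≤ ∑ C : ClassGroup (𝓞 K), (1 + η) / h * (x - ((χ₁ C : ℂ)).re * (x ^ β₁ / β₁)) :=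
          Finset.sum_le_sum fun C _ => hC C
      _ = (1 + η) / h * (h * x - S * (x ^ β₁ / β₁)) := by
          rw [← Finset.mul_sum, Finset.sum_sub_distrib, Finset.sum_const, Finset.card_univ,
            nsmul_eq_mul, hcard, hS, Finset.sum_mul]
      _ ≤ (1 + η) / h * (h * x) := by
          apply mul_le_mul_of_nonneg_left _ (by positivity)
          nlinarith
      _ = (1 + η) * x := by field_simp

/-! ### Landau's prime ideal theorem for a fixed field, in the `(1 ± η) x` form -/

/-- From `|θ¹_E(x) − x| ≤ C x e^{−c√log x}` (`x ≥ 2`) to `(1 − η) x ≤ θ¹_E(x) ≤ (1 + η) x` for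
`x ≥ x₀(E, η)`. [cite: LandauMathAnn1903, §13 p. 669] -/
theorem degreeOneTheta_eventually (E : Type*) [Field E] [NumberField E] {η : ℝ} (hη : 0 < η) :
    ∃ x₀ : ℝ, 2 ≤ x₀ ∧ ∀ x : ℝ, x₀ ≤ x →
      (1 - η) * x ≤ degreeOneTheta E x ∧ degreeOneTheta E x ≤ (1 + η) * x := by
  obtain ⟨c, hc, C, h⟩ := abs_degreeOneTheta_sub_self_le E
  -- threshold: `e^{−c √log x} ≤ 1/B` with `B = max 1 (C/η)` once `√log x ≥ log B / c`
  set B : ℝ := max 1 (C / η) with hB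
  have hB1 : 1 ≤ B := le_max_left _ _
  have hB0 : 0 < B := by linarith
  have hlogB : 0 ≤ Real.log B := Real.log_nonneg hB1
  refine ⟨max 2 (Real.exp ((Real.log B / c) ^ 2)), le_max_left _ _, fun x hx => ?_⟩
  have hx2 : 2 ≤ x := le_trans (le_max_left _ _) hx
  have hx0 : 0 < x := by linarith
  have hxe : Real.exp ((Real.log B / c) ^ 2) ≤ x := le_trans (le_max_right _ _) hx
  have hlogx : (Real.log B / c) ^ 2 ≤ Real.log x := by
    have := Real.log_le_log (Real.exp_pos _) hxe
    rwa [Real.log_exp] at this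
  have hsqrt : Real.log B / c ≤ Real.sqrt (Real.log x) := by
    have h1 : Real.sqrt ((Real.log B / c) ^ 2) = Real.log B / c :=
      Real.sqrt_sq (div_nonneg hlogB hc.le)
    rw [← h1]
    exact Real.sqrt_le_sqrt hlogx
  have hexp : Real.exp (-c * Real.sqrt (Real.log x)) ≤ 1 / B := by
    rw [show (1 : ℝ) / B = Real.exp (-Real.log B) by rw [Real.exp_neg, Real.exp_log hB0, one_div],
      Real.exp_le_exp]
    have : Real.log B ≤ c * Real.sqrt (Real.log x) := by
      have := mul_le_mul_of_nonneg_left hsqrt hc.le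
      rwa [mul_div_cancel₀ _ hc.ne'] at this
    linarith
  have hmain : C * x * Real.exp (-c * Real.sqrt (Real.log x)) ≤ η * x := by
    rcases le_or_gt C 0 with hC | hC
    · have : C * x * Real.exp (-c * Real.sqrt (Real.log x)) ≤ 0 :=
        mul_nonpos_of_nonpos_of_nonneg (mul_nonpos_of_nonpos_of_nonneg hC hx0.le) (Real.exp_nonneg _)
      nlinarith
    · have hBC : C / η ≤ B := le_max_right _ _
      have h1 : 1 / B ≤ η / C := by
        rw [div_le_div_iff₀ hB0 hC]
        rw [div_le_iff₀ hη] at hBC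
        linarith
      calc C * x * Real.exp (-c * Real.sqrt (Real.log x)) ≤ C * x * (η / C) :=
            mul_le_mul_of_nonneg_left (hexp.trans h1) (by positivity)
        _ = η * x := by field_simp
  have habs := (abs_le.mp ((h x hx2).trans hmain))
  constructor <;> linarith [habs.1, habs.2]

/-- **`θ(x) ≥ (1 − η) x` for `x ≥ x₀(η)`** (the prime number theorem for `ℚ`, read through
`degreeOneTheta ℚ = θ`: every prime has exactly one ideal of norm `p` in `ℤ`). [folklore] -/
theorem chebyshevTheta_eventually_ge {η : ℝ} (hη : 0 < η) :
    ∃ x₀ : ℝ, 2 ≤ x₀ ∧ ∀ x : ℝ, x₀ ≤ x → (1 - η) * x ≤ Chebyshev.theta x := by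
  obtain ⟨x₀, hx₀, h⟩ := degreeOneTheta_eventually ℚ hη
  refine ⟨x₀, hx₀, fun x hx => ?_⟩
  have hθ : degreeOneTheta ℚ x = Chebyshev.theta x := by
    rw [degreeOneTheta, Chebyshev.theta_eq_sum_primesLE]
    refine Finset.sum_congr rfl fun p _ => ?_
    rw [idealNormCount_rat, Nat.cast_one, one_mul]
  rw [← hθ]
  exact (h x hx).1

end Summit.QuantumAdvantage.QuantumAdvantage.Theorems.DegreeOnePrimesEscape

end
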